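import Mathlib
import Summits.ValiantsHypothesis.ValiantsHypothesis.Theorems.KPlusLogSqLawStepTriple

/-!
# The TRIPLE LAW — the four orientation cases (static path model behind `KPlusLogSqLaw.TropicalB`)

Cell pub-symmetroid, seat conjb-2 (g21). A helper toward the crux `TropicalB`
(`Summit.ValiantsHypothesis.ValiantsHypothesis.Theses.KPlusLogSqLaw.TropicalB`, item
`stmt-ValiantsHypothesis-19771`); it earns no crux credit and is not evidence for `MatrixDescartes` or for
Valiant's hypothesis.

THEOREM (TRIPLE LAW, THEORY-NOTE-g21 §3.1quinquies; mechanism in `KPlusLogSqLawStepTriple`). Rows `i`, `i+1`, `i+2`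
all step (reach `d ≥ 2`; classes: `i+2`, `i+d+1`, `i+d+3` upper, `i+1`, `i+d+2` lower), the step at row `i+1` moves
RIGHT (`T[i+1, i+d+1] < T[i+2, i+d+2]`): then `s (i+2) < s (i+d+1)`, whatever the directions of the steps at rows
`i` and `i+2`:

* `triple_rrr`, `triple_rrl` — row `i` moving right (needs row-`i` exactness: `[i, i+d+1]` nowhere separated),
  row `i+2` moving right / left;
* `triple_lrr`, `triple_lrl` — row `i` moving left (the look-back case; `T[i, i+d] ≠ ∅` suffices), row `i+2`
  moving right / left.

When the step at row `i+1` moves LEFT the conclusion is `s (i+d+1) < s (i+2)` (apply these to `θ ↦ -θ`); for an odd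
first line negate all lines. With the STEP CRITERION at row `i+1` this is the parity-free form
`(s (i+d+1) - s (i+2)) * (s (i+d+2) - s (i+1)) < 0`, the third condition of the located-exact THREE-STEP PLATEAU
CRITERION.
-/

set_option linter.dupNamespace false

namespace Summit.ValiantsHypothesis.ValiantsHypothesis.Theorems.KPlusLogSqLawStepTripleCases

open Summit.ValiantsHypothesis.ValiantsHypothesis.Theorems.KPlusLogSqLawStepSupStructure (step_sup_structure)
open Summit.ValiantsHypothesis.ValiantsHypothesis.Theorems.KPlusLogSqLawStepTriple (exact_row_gap
  triple_same_abstract triple_zig_abstract step_inf_structure lookback_partner)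

/-- `c (ρ) ≥ 0` and the position facts at the tight end of `T[i+2, i+d+2]`, row `i+2` moving right. -/
theorem row2_right (up : ℕ → Prop) (s b : ℕ → ℝ) (i d : ℕ) (hd : 1 ≤ d) (hup2 : up (i + 2))
    (hup1 : up (i + d + 1)) (hlow2 : ¬ up (i + d + 2)) (hup3 : up (i + d + 3))
    (hA2 : ∃ θ : ℝ, ∀ e o : ℕ, i + 2 ≤ e → e ≤ i + d + 2 → i + 2 ≤ o → o ≤ i + d + 2 → up e → ¬ up o →
      b o + s o * θ < b e + s e * θ)
    (hA3 : ∃ θ : ℝ, ∀ e o : ℕ, i + 3 ≤ e → e ≤ i + d + 3 → i + 3 ≤ o → o ≤ i + d + 3 → up e → ¬ up o →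
      b o + s o * θ < b e + s e * θ)
    (hA23 : ∀ θ : ℝ, ¬ ((∀ e o : ℕ, i + 2 ≤ e → e ≤ i + d + 2 → i + 2 ≤ o → o ≤ i + d + 2 → up e → ¬ up o →
      b o + s o * θ < b e + s e * θ) ∧ (∀ e o : ℕ, i + 3 ≤ e → e ≤ i + d + 3 → i + 3 ≤ o → o ≤ i + d + 3 →
      up e → ¬ up o → b o + s o * θ < b e + s e * θ)))
    (hord23 : ∀ θ θ' : ℝ, (∀ e o : ℕ, i + 2 ≤ e → e ≤ i + d + 2 → i + 2 ≤ o → o ≤ i + d + 2 → up e → ¬ up o →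
      b o + s o * θ < b e + s e * θ) → (∀ e o : ℕ, i + 3 ≤ e → e ≤ i + d + 3 → i + 3 ≤ o → o ≤ i + d + 3 →
      up e → ¬ up o → b o + s o * θ' < b e + s e * θ') → θ < θ') :
    ∃ ρ : ℝ, b (i + 2) + s (i + 2) * ρ ≤ b (i + d + 1) + s (i + d + 1) * ρ ∧
      (∀ θ : ℝ, (∀ e o : ℕ, i + 2 ≤ e → e ≤ i + d + 2 → i + 2 ≤ o → o ≤ i + d + 2 → up e → ¬ up o →
        b o + s o * θ < b e + s e * θ) → θ ≤ ρ) := by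
  classical
  obtain ⟨θ₂, hθ₂⟩ := hA2
  obtain ⟨θ₃, hθ₃⟩ := hA3
  have hup3' : up (i + 2 + d + 1) := by
    rw [show i + 2 + d + 1 = i + d + 3 by omega]; exact hup3
  have hlow' : ∃ o : ℕ, i + 2 + 1 ≤ o ∧ o ≤ i + 2 + d ∧ ¬ up o := ⟨i + d + 2, by omega, by omega, hlow2⟩
  obtain ⟨ρ, o₂, ho1, ho2, hou, -, -, heq2, hdom2, hsup2, -, -⟩ :=
    step_sup_structure up s b (i + 2) d hup2 hup3' hlow'
      ⟨θ₂, fun e o h1 h2 h3 h4 he ho => hθ₂ e o h1 (by omega) h3 (by omega) he ho⟩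
      ⟨θ₃, fun e o h1 h2 h3 h4 he ho => hθ₃ e o (by omega) (by omega) (by omega) (by omega) he ho⟩
      (fun θ hθ => hA23 θ
        ⟨fun e o h1 h2 h3 h4 he ho => hθ.1 e o h1 (by omega) h3 (by omega) he ho,
         fun e o h1 h2 h3 h4 he ho => hθ.2 e o (by omega) (by omega) (by omega) (by omega) he ho⟩)
      (fun θ θ' hθ hθ' => hord23 θ θ'
        (fun e o h1 h2 h3 h4 he ho => hθ e o h1 (by omega) h3 (by omega) he ho)
        (fun e o h1 h2 h3 h4 he ho => hθ' e o (by omega) (by omega) (by omega) (by omega) he ho))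
  refine ⟨ρ, ?_, fun θ hθ => hsup2 θ (fun e o h1 h2 h3 h4 he ho => hθ e o h1 (by omega) h3 (by omega) he ho)⟩
  have := hdom2 (i + d + 1) o₂ (by omega) (by omega) (by omega) ho2 hup1 hou
  linarith

/-- `c (ρ) ≥ 0` and the position facts at the tight end of `T[i+2, i+d+2]`, row `i+2` moving left. -/
theorem row2_left (up : ℕ → Prop) (s b : ℕ → ℝ) (i d : ℕ) (hd : 1 ≤ d) (hup2 : up (i + 2))
    (hup1 : up (i + d + 1)) (hlow2 : ¬ up (i + d + 2)) (hup3 : up (i + d + 3))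
    (hA2 : ∃ θ : ℝ, ∀ e o : ℕ, i + 2 ≤ e → e ≤ i + d + 2 → i + 2 ≤ o → o ≤ i + d + 2 → up e → ¬ up o →
      b o + s o * θ < b e + s e * θ)
    (hA3 : ∃ θ : ℝ, ∀ e o : ℕ, i + 3 ≤ e → e ≤ i + d + 3 → i + 3 ≤ o → o ≤ i + d + 3 → up e → ¬ up o →
      b o + s o * θ < b e + s e * θ)
    (hA23 : ∀ θ : ℝ, ¬ ((∀ e o : ℕ, i + 2 ≤ e → e ≤ i + d + 2 → i + 2 ≤ o → o ≤ i + d + 2 → up e → ¬ up o →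
      b o + s o * θ < b e + s e * θ) ∧ (∀ e o : ℕ, i + 3 ≤ e → e ≤ i + d + 3 → i + 3 ≤ o → o ≤ i + d + 3 →
      up e → ¬ up o → b o + s o * θ < b e + s e * θ)))
    (hord32 : ∀ θ θ' : ℝ, (∀ e o : ℕ, i + 2 ≤ e → e ≤ i + d + 2 → i + 2 ≤ o → o ≤ i + d + 2 → up e → ¬ up o →
      b o + s o * θ < b e + s e * θ) → (∀ e o : ℕ, i + 3 ≤ e → e ≤ i + d + 3 → i + 3 ≤ o → o ≤ i + d + 3 →
      up e → ¬ up o → b o + s o * θ' < b e + s e * θ') → θ' < θ) :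
    ∃ ρ : ℝ, b (i + 2) + s (i + 2) * ρ ≤ b (i + d + 1) + s (i + d + 1) * ρ ∧
      (∀ θ : ℝ, (∀ e o : ℕ, i + 2 ≤ e → e ≤ i + d + 2 → i + 2 ≤ o → o ≤ i + d + 2 → up e → ¬ up o →
        b o + s o * θ < b e + s e * θ) → ρ ≤ θ) ∧
      (∀ ε : ℝ, 0 < ε → ∃ θ : ℝ, (∀ e o : ℕ, i + 2 ≤ e → e ≤ i + d + 2 → i + 2 ≤ o → o ≤ i + d + 2 → up e →
        ¬ up o → b o + s o * θ < b e + s e * θ) ∧ θ < ρ + ε) := by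
  classical
  obtain ⟨θ₂, hθ₂⟩ := hA2
  obtain ⟨θ₃, hθ₃⟩ := hA3
  have hup3' : up (i + 2 + d + 1) := by
    rw [show i + 2 + d + 1 = i + d + 3 by omega]; exact hup3
  have hlow' : ∃ o : ℕ, i + 2 + 1 ≤ o ∧ o ≤ i + 2 + d ∧ ¬ up o := ⟨i + d + 2, by omega, by omega, hlow2⟩
  obtain ⟨ρ, o₂, ho1, ho2, hou, heq2, hdom2, hinf2, happ2, -⟩ :=
    step_inf_structure up s b (i + 2) d hup2 hup3' hlow'
      ⟨θ₂, fun e o h1 h2 h3 h4 he ho => hθ₂ e o h1 (by omega) h3 (by omega) he ho⟩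
      ⟨θ₃, fun e o h1 h2 h3 h4 he ho => hθ₃ e o (by omega) (by omega) (by omega) (by omega) he ho⟩
      (fun θ hθ => hA23 θ
        ⟨fun e o h1 h2 h3 h4 he ho => hθ.1 e o h1 (by omega) h3 (by omega) he ho,
         fun e o h1 h2 h3 h4 he ho => hθ.2 e o (by omega) (by omega) (by omega) (by omega) he ho⟩)
      (fun θ θ' hθ hθ' => hord32 θ θ'
        (fun e o h1 h2 h3 h4 he ho => hθ e o h1 (by omega) h3 (by omega) he ho)
        (fun e o h1 h2 h3 h4 he ho => hθ' e o (by omega) (by omega) (by omega) (by omega) he ho))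
  refine ⟨ρ, ?_, fun θ hθ => hinf2 θ (fun e o h1 h2 h3 h4 he ho => hθ e o h1 (by omega) h3 (by omega) he ho), ?_⟩
  · have := hdom2 (i + d + 1) o₂ (by omega) (by omega) (by omega) ho2 hup1 hou
    linarith
  · intro ε hε
    obtain ⟨θ, hθ, hlt⟩ := happ2 ε hε
    exact ⟨θ, fun e o h1 h2 h3 h4 he ho => hθ e o h1 (by omega) h3 (by omega) he ho, hlt⟩

/-- TRIPLE LAW, directions (right, right, right), row `i` of reach exactly `d`. -/
theorem triple_rrr (up : ℕ → Prop) (s b : ℕ → ℝ) (i d : ℕ) (hd : 2 ≤ d) (hup2 : up (i + 2))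
    (hup1 : up (i + d + 1)) (hlow2 : ¬ up (i + d + 2)) (hup3 : up (i + d + 3))
    (hA0 : ∃ θ : ℝ, ∀ e o : ℕ, i ≤ e → e ≤ i + d → i ≤ o → o ≤ i + d → up e → ¬ up o →
      b o + s o * θ < b e + s e * θ)
    (hex : ∀ θ : ℝ, ¬ (∀ e o : ℕ, i ≤ e → e ≤ i + d + 1 → i ≤ o → o ≤ i + d + 1 → up e → ¬ up o →
      b o + s o * θ < b e + s e * θ))
    (hA1 : ∃ θ : ℝ, ∀ e o : ℕ, i + 1 ≤ e → e ≤ i + d + 1 → i + 1 ≤ o → o ≤ i + d + 1 → up e → ¬ up o →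
      b o + s o * θ < b e + s e * θ)
    (hA2 : ∃ θ : ℝ, ∀ e o : ℕ, i + 2 ≤ e → e ≤ i + d + 2 → i + 2 ≤ o → o ≤ i + d + 2 → up e → ¬ up o →
      b o + s o * θ < b e + s e * θ)
    (hA3 : ∃ θ : ℝ, ∀ e o : ℕ, i + 3 ≤ e → e ≤ i + d + 3 → i + 3 ≤ o → o ≤ i + d + 3 → up e → ¬ up o →
      b o + s o * θ < b e + s e * θ)
    (hord01 : ∀ θ θ' : ℝ, (∀ e o : ℕ, i ≤ e → e ≤ i + d → i ≤ o → o ≤ i + d → up e → ¬ up o →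
      b o + s o * θ < b e + s e * θ) → (∀ e o : ℕ, i + 1 ≤ e → e ≤ i + d + 1 → i + 1 ≤ o → o ≤ i + d + 1 →
      up e → ¬ up o → b o + s o * θ' < b e + s e * θ') → θ < θ')
    (hord12 : ∀ θ θ' : ℝ, (∀ e o : ℕ, i + 1 ≤ e → e ≤ i + d + 1 → i + 1 ≤ o → o ≤ i + d + 1 → up e → ¬ up o →
      b o + s o * θ < b e + s e * θ) → (∀ e o : ℕ, i + 2 ≤ e → e ≤ i + d + 2 → i + 2 ≤ o → o ≤ i + d + 2 →
      up e → ¬ up o → b o + s o * θ' < b e + s e * θ') → θ < θ')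
    (hA23 : ∀ θ : ℝ, ¬ ((∀ e o : ℕ, i + 2 ≤ e → e ≤ i + d + 2 → i + 2 ≤ o → o ≤ i + d + 2 → up e → ¬ up o →
      b o + s o * θ < b e + s e * θ) ∧ (∀ e o : ℕ, i + 3 ≤ e → e ≤ i + d + 3 → i + 3 ≤ o → o ≤ i + d + 3 →
      up e → ¬ up o → b o + s o * θ < b e + s e * θ)))
    (hord23 : ∀ θ θ' : ℝ, (∀ e o : ℕ, i + 2 ≤ e → e ≤ i + d + 2 → i + 2 ≤ o → o ≤ i + d + 2 → up e → ¬ up o →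
      b o + s o * θ < b e + s e * θ) → (∀ e o : ℕ, i + 3 ≤ e → e ≤ i + d + 3 → i + 3 ≤ o → o ≤ i + d + 3 →
      up e → ¬ up o → b o + s o * θ' < b e + s e * θ') → θ < θ') :
    s (i + 2) < s (i + d + 1) := by
  obtain ⟨θ₀, hθ₀⟩ := hA0
  obtain ⟨θ₁, hθ₁⟩ := hA1
  obtain ⟨θ₂, hθ₂⟩ := id hA2
  obtain ⟨ρ, hcρ, hsup⟩ := row2_right up s b i d (by omega) hup2 hup1 hlow2 hup3 hA2 hA3 hA23 hord23
  have h01 : θ₀ < θ₁ := hord01 θ₀ θ₁ hθ₀ hθ₁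
  have h12 : θ₁ < θ₂ := hord12 θ₁ θ₂ hθ₁ hθ₂
  have h2ρ : θ₂ ≤ ρ := hsup θ₂ hθ₂
  have hc0 := exact_row_gap up s b i d θ₀ hd hup2 hup1 hθ₀ (hex θ₀)
  exact triple_same_abstract s b i d θ₀ ρ hc0 (by linarith) hcρ

/-- TRIPLE LAW, directions (right, right, left), row `i` of reach exactly `d`. -/
theorem triple_rrl (up : ℕ → Prop) (s b : ℕ → ℝ) (i d : ℕ) (hd : 2 ≤ d) (hup2 : up (i + 2))
    (hup1 : up (i + d + 1)) (hlow2 : ¬ up (i + d + 2)) (hup3 : up (i + d + 3))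
    (hA0 : ∃ θ : ℝ, ∀ e o : ℕ, i ≤ e → e ≤ i + d → i ≤ o → o ≤ i + d → up e → ¬ up o →
      b o + s o * θ < b e + s e * θ)
    (hex : ∀ θ : ℝ, ¬ (∀ e o : ℕ, i ≤ e → e ≤ i + d + 1 → i ≤ o → o ≤ i + d + 1 → up e → ¬ up o →
      b o + s o * θ < b e + s e * θ))
    (hA1 : ∃ θ : ℝ, ∀ e o : ℕ, i + 1 ≤ e → e ≤ i + d + 1 → i + 1 ≤ o → o ≤ i + d + 1 → up e → ¬ up o →
      b o + s o * θ < b e + s e * θ)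
    (hA2 : ∃ θ : ℝ, ∀ e o : ℕ, i + 2 ≤ e → e ≤ i + d + 2 → i + 2 ≤ o → o ≤ i + d + 2 → up e → ¬ up o →
      b o + s o * θ < b e + s e * θ)
    (hA3 : ∃ θ : ℝ, ∀ e o : ℕ, i + 3 ≤ e → e ≤ i + d + 3 → i + 3 ≤ o → o ≤ i + d + 3 → up e → ¬ up o →
      b o + s o * θ < b e + s e * θ)
    (hord01 : ∀ θ θ' : ℝ, (∀ e o : ℕ, i ≤ e → e ≤ i + d → i ≤ o → o ≤ i + d → up e → ¬ up o →
      b o + s o * θ < b e + s e * θ) → (∀ e o : ℕ, i + 1 ≤ e → e ≤ i + d + 1 → i + 1 ≤ o → o ≤ i + d + 1 →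
      up e → ¬ up o → b o + s o * θ' < b e + s e * θ') → θ < θ')
    (hord12 : ∀ θ θ' : ℝ, (∀ e o : ℕ, i + 1 ≤ e → e ≤ i + d + 1 → i + 1 ≤ o → o ≤ i + d + 1 → up e → ¬ up o →
      b o + s o * θ < b e + s e * θ) → (∀ e o : ℕ, i + 2 ≤ e → e ≤ i + d + 2 → i + 2 ≤ o → o ≤ i + d + 2 →
      up e → ¬ up o → b o + s o * θ' < b e + s e * θ') → θ < θ')
    (hA23 : ∀ θ : ℝ, ¬ ((∀ e o : ℕ, i + 2 ≤ e → e ≤ i + d + 2 → i + 2 ≤ o → o ≤ i + d + 2 → up e → ¬ up o →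
      b o + s o * θ < b e + s e * θ) ∧ (∀ e o : ℕ, i + 3 ≤ e → e ≤ i + d + 3 → i + 3 ≤ o → o ≤ i + d + 3 →
      up e → ¬ up o → b o + s o * θ < b e + s e * θ)))
    (hord32 : ∀ θ θ' : ℝ, (∀ e o : ℕ, i + 2 ≤ e → e ≤ i + d + 2 → i + 2 ≤ o → o ≤ i + d + 2 → up e → ¬ up o →
      b o + s o * θ < b e + s e * θ) → (∀ e o : ℕ, i + 3 ≤ e → e ≤ i + d + 3 → i + 3 ≤ o → o ≤ i + d + 3 →
      up e → ¬ up o → b o + s o * θ' < b e + s e * θ') → θ' < θ) :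
    s (i + 2) < s (i + d + 1) := by
  obtain ⟨θ₀, hθ₀⟩ := hA0
  obtain ⟨θ₁, hθ₁⟩ := hA1
  obtain ⟨ρ, hcρ, hinf, happ⟩ := row2_left up s b i d (by omega) hup2 hup1 hlow2 hup3 hA2 hA3 hA23 hord32
  have h01 : θ₀ < θ₁ := hord01 θ₀ θ₁ hθ₀ hθ₁
  -- `θ₁ ≤ ρ = inf T[i+2, i+d+2]`
  have h1ρ : θ₁ ≤ ρ := by
    by_contra hcon
    have hlt : ρ < θ₁ := lt_of_not_ge hcon
    obtain ⟨θ, hθ, hθlt⟩ := happ (θ₁ - ρ) (by linarith)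
    have := hord12 θ₁ θ hθ₁ hθ
    linarith
  have hc0 := exact_row_gap up s b i d θ₀ hd hup2 hup1 hθ₀ (hex θ₀)
  exact triple_same_abstract s b i d θ₀ ρ hc0 (by linarith) hcρ

/-- TRIPLE LAW, directions (left, right, right) — look-back case; `T[i, i+d] ≠ ∅` suffices for row `i`. -/
theorem triple_lrr (up : ℕ → Prop) (s b : ℕ → ℝ) (i d : ℕ) (hd : 2 ≤ d) (hlow1 : ¬ up (i + 1))
    (hup2 : up (i + 2)) (hup1 : up (i + d + 1)) (hlow2 : ¬ up (i + d + 2)) (hup3 : up (i + d + 3))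
    (hA0 : ∃ θ : ℝ, ∀ e o : ℕ, i ≤ e → e ≤ i + d → i ≤ o → o ≤ i + d → up e → ¬ up o →
      b o + s o * θ < b e + s e * θ)
    (hA1 : ∃ θ : ℝ, ∀ e o : ℕ, i + 1 ≤ e → e ≤ i + d + 1 → i + 1 ≤ o → o ≤ i + d + 1 → up e → ¬ up o →
      b o + s o * θ < b e + s e * θ)
    (hA2 : ∃ θ : ℝ, ∀ e o : ℕ, i + 2 ≤ e → e ≤ i + d + 2 → i + 2 ≤ o → o ≤ i + d + 2 → up e → ¬ up o →
      b o + s o * θ < b e + s e * θ)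
    (hA3 : ∃ θ : ℝ, ∀ e o : ℕ, i + 3 ≤ e → e ≤ i + d + 3 → i + 3 ≤ o → o ≤ i + d + 3 → up e → ¬ up o →
      b o + s o * θ < b e + s e * θ)
    (hord10 : ∀ θ θ' : ℝ, (∀ e o : ℕ, i + 1 ≤ e → e ≤ i + d + 1 → i + 1 ≤ o → o ≤ i + d + 1 → up e → ¬ up o →
      b o + s o * θ < b e + s e * θ) → (∀ e o : ℕ, i ≤ e → e ≤ i + d → i ≤ o → o ≤ i + d →
      up e → ¬ up o → b o + s o * θ' < b e + s e * θ') → θ < θ')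
    (hA12 : ∀ θ : ℝ, ¬ ((∀ e o : ℕ, i + 1 ≤ e → e ≤ i + d + 1 → i + 1 ≤ o → o ≤ i + d + 1 → up e → ¬ up o →
      b o + s o * θ < b e + s e * θ) ∧ (∀ e o : ℕ, i + 2 ≤ e → e ≤ i + d + 2 → i + 2 ≤ o → o ≤ i + d + 2 →
      up e → ¬ up o → b o + s o * θ < b e + s e * θ)))
    (hord12 : ∀ θ θ' : ℝ, (∀ e o : ℕ, i + 1 ≤ e → e ≤ i + d + 1 → i + 1 ≤ o → o ≤ i + d + 1 → up e → ¬ up o →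
      b o + s o * θ < b e + s e * θ) → (∀ e o : ℕ, i + 2 ≤ e → e ≤ i + d + 2 → i + 2 ≤ o → o ≤ i + d + 2 →
      up e → ¬ up o → b o + s o * θ' < b e + s e * θ') → θ < θ')
    (hA23 : ∀ θ : ℝ, ¬ ((∀ e o : ℕ, i + 2 ≤ e → e ≤ i + d + 2 → i + 2 ≤ o → o ≤ i + d + 2 → up e → ¬ up o →
      b o + s o * θ < b e + s e * θ) ∧ (∀ e o : ℕ, i + 3 ≤ e → e ≤ i + d + 3 → i + 3 ≤ o → o ≤ i + d + 3 →
      up e → ¬ up o → b o + s o * θ < b e + s e * θ)))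
    (hord23 : ∀ θ θ' : ℝ, (∀ e o : ℕ, i + 2 ≤ e → e ≤ i + d + 2 → i + 2 ≤ o → o ≤ i + d + 2 → up e → ¬ up o →
      b o + s o * θ < b e + s e * θ) → (∀ e o : ℕ, i + 3 ≤ e → e ≤ i + d + 3 → i + 3 ≤ o → o ≤ i + d + 3 →
      up e → ¬ up o → b o + s o * θ' < b e + s e * θ') → θ < θ') :
    s (i + 2) < s (i + d + 1) := by
  obtain ⟨θ₀, hθ₀⟩ := id hA0
  obtain ⟨θ₂, hθ₂⟩ := id hA2
  obtain ⟨r₁, heq1, -, -, hdom1, hsup1, happ1, hgt1, hright⟩ :=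
    lookback_partner up s b i d (by omega) hlow1 hup2 hlow2 hA0 hA1 hA2 hord10 hA12 hord12
  obtain ⟨ρ, hcρ, hsup2⟩ := row2_right up s b i d (by omega) hup2 hup1 hlow2 hup3 hA2 hA3 hA23 hord23
  have hr₁ρ : r₁ ≤ ρ := by
    have h1 := hgt1 θ₂ hθ₂
    have h2 := hsup2 θ₂ hθ₂
    linarith
  have hq0 := hθ₀ (i + 2) (i + 1) (by omega) (by omega) (by omega) (by omega) hup2 hlow1
  have hdom1' := hdom1 (i + 2) (i + 1) (by omega) (by omega) (by omega) (by omega) hup2 hlow1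
  have happ1' : ∀ ε : ℝ, 0 < ε → ∃ θ : ℝ,
      b (i + 1) + s (i + 1) * θ < b (i + 2) + s (i + 2) * θ ∧ r₁ - ε < θ ∧ θ ≤ r₁ := by
    intro ε hε
    obtain ⟨θ, hθ, hθlt⟩ := happ1 ε hε
    exact ⟨θ, hθ (i + 2) (i + 1) (by omega) (by omega) (by omega) (by omega) hup2 hlow1, hθlt, hsup1 θ hθ⟩
  exact triple_zig_abstract s b i d r₁ ρ θ₀ hq0 (hright θ₀ hθ₀) heq1 hdom1' happ1' hr₁ρ hcρ

/-- TRIPLE LAW, directions (left, right, left) — look-back case; `T[i, i+d] ≠ ∅` suffices for row `i`. -/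
theorem triple_lrl (up : ℕ → Prop) (s b : ℕ → ℝ) (i d : ℕ) (hd : 2 ≤ d) (hlow1 : ¬ up (i + 1))
    (hup2 : up (i + 2)) (hup1 : up (i + d + 1)) (hlow2 : ¬ up (i + d + 2)) (hup3 : up (i + d + 3))
    (hA0 : ∃ θ : ℝ, ∀ e o : ℕ, i ≤ e → e ≤ i + d → i ≤ o → o ≤ i + d → up e → ¬ up o →
      b o + s o * θ < b e + s e * θ)
    (hA1 : ∃ θ : ℝ, ∀ e o : ℕ, i + 1 ≤ e → e ≤ i + d + 1 → i + 1 ≤ o → o ≤ i + d + 1 → up e → ¬ up o →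
      b o + s o * θ < b e + s e * θ)
    (hA2 : ∃ θ : ℝ, ∀ e o : ℕ, i + 2 ≤ e → e ≤ i + d + 2 → i + 2 ≤ o → o ≤ i + d + 2 → up e → ¬ up o →
      b o + s o * θ < b e + s e * θ)
    (hA3 : ∃ θ : ℝ, ∀ e o : ℕ, i + 3 ≤ e → e ≤ i + d + 3 → i + 3 ≤ o → o ≤ i + d + 3 → up e → ¬ up o →
      b o + s o * θ < b e + s e * θ)
    (hord10 : ∀ θ θ' : ℝ, (∀ e o : ℕ, i + 1 ≤ e → e ≤ i + d + 1 → i + 1 ≤ o → o ≤ i + d + 1 → up e → ¬ up o →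
      b o + s o * θ < b e + s e * θ) → (∀ e o : ℕ, i ≤ e → e ≤ i + d → i ≤ o → o ≤ i + d →
      up e → ¬ up o → b o + s o * θ' < b e + s e * θ') → θ < θ')
    (hA12 : ∀ θ : ℝ, ¬ ((∀ e o : ℕ, i + 1 ≤ e → e ≤ i + d + 1 → i + 1 ≤ o → o ≤ i + d + 1 → up e → ¬ up o →
      b o + s o * θ < b e + s e * θ) ∧ (∀ e o : ℕ, i + 2 ≤ e → e ≤ i + d + 2 → i + 2 ≤ o → o ≤ i + d + 2 →
      up e → ¬ up o → b o + s o * θ < b e + s e * θ)))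
    (hord12 : ∀ θ θ' : ℝ, (∀ e o : ℕ, i + 1 ≤ e → e ≤ i + d + 1 → i + 1 ≤ o → o ≤ i + d + 1 → up e → ¬ up o →
      b o + s o * θ < b e + s e * θ) → (∀ e o : ℕ, i + 2 ≤ e → e ≤ i + d + 2 → i + 2 ≤ o → o ≤ i + d + 2 →
      up e → ¬ up o → b o + s o * θ' < b e + s e * θ') → θ < θ')
    (hA23 : ∀ θ : ℝ, ¬ ((∀ e o : ℕ, i + 2 ≤ e → e ≤ i + d + 2 → i + 2 ≤ o → o ≤ i + d + 2 → up e → ¬ up o →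
      b o + s o * θ < b e + s e * θ) ∧ (∀ e o : ℕ, i + 3 ≤ e → e ≤ i + d + 3 → i + 3 ≤ o → o ≤ i + d + 3 →
      up e → ¬ up o → b o + s o * θ < b e + s e * θ)))
    (hord32 : ∀ θ θ' : ℝ, (∀ e o : ℕ, i + 2 ≤ e → e ≤ i + d + 2 → i + 2 ≤ o → o ≤ i + d + 2 → up e → ¬ up o →
      b o + s o * θ < b e + s e * θ) → (∀ e o : ℕ, i + 3 ≤ e → e ≤ i + d + 3 → i + 3 ≤ o → o ≤ i + d + 3 →
      up e → ¬ up o → b o + s o * θ' < b e + s e * θ') → θ' < θ) :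
    s (i + 2) < s (i + d + 1) := by
  obtain ⟨θ₀, hθ₀⟩ := id hA0
  obtain ⟨r₁, heq1, -, -, hdom1, hsup1, happ1, hgt1, hright⟩ :=
    lookback_partner up s b i d (by omega) hlow1 hup2 hlow2 hA0 hA1 hA2 hord10 hA12 hord12
  obtain ⟨ρ, hcρ, hinf2, happ2⟩ := row2_left up s b i d (by omega) hup2 hup1 hlow2 hup3 hA2 hA3 hA23 hord32
  -- `r₁ ≤ ρ = inf T[i+2, i+d+2]` since `T[i+2, i+d+2]` lies beyond `r₁`
  have hr₁ρ : r₁ ≤ ρ := by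
    by_contra hcon
    have hlt : ρ < r₁ := lt_of_not_ge hcon
    obtain ⟨θ, hθ, hθlt⟩ := happ2 (r₁ - ρ) (by linarith)
    have := hgt1 θ hθ
    linarith
  have hq0 := hθ₀ (i + 2) (i + 1) (by omega) (by omega) (by omega) (by omega) hup2 hlow1
  have hdom1' := hdom1 (i + 2) (i + 1) (by omega) (by omega) (by omega) (by omega) hup2 hlow1
  have happ1' : ∀ ε : ℝ, 0 < ε → ∃ θ : ℝ,
      b (i + 1) + s (i + 1) * θ < b (i + 2) + s (i + 2) * θ ∧ r₁ - ε < θ ∧ θ ≤ r₁ := by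
    intro ε hε
    obtain ⟨θ, hθ, hθlt⟩ := happ1 ε hε
    exact ⟨θ, hθ (i + 2) (i + 1) (by omega) (by omega) (by omega) (by omega) hup2 hlow1, hθlt, hsup1 θ hθ⟩
  exact triple_zig_abstract s b i d r₁ ρ θ₀ hq0 (hright θ₀ hθ₀) heq1 hdom1' happ1' hr₁ρ hcρ

end Summit.ValiantsHypothesis.ValiantsHypothesis.Theorems.KPlusLogSqLawStepTripleCases
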